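import Literature.MathematicalPhysics.QuantumFieldTheory.Balaban1983to89.B9Eq319BlockTentLift

/-!
# `Balaban1983to89.B9Eq3126BondLiftEnergy` — T. Bałaban, *Propagators for lattice gauge theories in a background field*, Commun. Math. Phys. **99** (1985)
# 389–434 [Balaban1985BackgroundPropagators] (3.4) p. 391, (3.8) p. 392, (3.10)–(3.11) p. 392 with (3.126) p. 420 and Thm 3.11 p. 416: **THE TWO
# DIRICHLET FORMS `‖D*u‖²` AND `‖curl u‖²` OF A FINE BOND FIELD AT FLAT TRANSPORTERS FROM A PER-STEP BOUND `‖u(x+e_μ,κ) − u(x,κ)‖ ≤ D‖ψ(blk x,κ)‖`,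
# AND THAT BOUND FOR THE TWO-PROFILE LIFT `u(x,κ) = f₁(off_κ x)·Π_{ν≠κ}f₀(off_ν x)·ψ(blk x,κ)`** — the energy half of the BOND analogue of ne9-leaf-01's
# site kit `B9Eq319BlockTentLift`, for the test family of the pub-balaban NE9 chain's variational `H₁`-currency (`B9Eq3126GreenLettersVariational`)

statement-level skeleton of published theorems with citation tags; proofs where landed; nothing here is a claim about the Yang–Mills mass gap

CITATION HEADER (lean-in-tree rule).  Audit cell `pub-balaban`, sub-cell `t4`, BINDER row NE9; filed by NE9 formalisation-swarm LEAF PROVER 02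
(`b2b-balaban-t4-ne9-formalise-leaf-02`, gen 65).  Sources READ in the held text layers: [Balaban1985BackgroundPropagators]
(`paper:balaban1985-cmp99-background-propagators`, journal page = PDF page + 388) pp. 391–392 (3.4), (3.8), (3.10)–(3.11), p. 416 Thm 3.11, p. 420 (3.126);
[Balaban1985Averaging] (`paper:balaban1985-cmp98-averaging`, journal page = PDF page + 16) p. 17 (2) (blocks and offsets, via the tree's `B9Eq319QprimeTorus`).

THE PRINT (verbatim).  [B9] p. 391, after (3.4): *«(D_μ A_ν)(x) = η⁻¹(R(U(x, x+ηe_μ))A_ν(x+ηe_μ) − A_ν(x))»*; (3.8) p. 392: *«(D*A)(x) = Σ_μ η⁻¹(R(U(x, x − ηe_μ))A(x −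
ηe_μ, x) − A(x, x + ηe_μ))»*; (3.10) p. 392 `Δ(U) = D*D + Δ′`; (3.11) p. 392 the `η^d`-weighted pairings; p. 416, Thm 3.11: *«the operators Δ′_a, G′, (Q′G′²Q′*)⁻¹,
Δ_a, G are positive definite»*; p. 420, (3.126): *«HB = GQ*(QGQ*)⁻¹B»*.

WHY THIS FILE (cell context).  The variational floor of `K = QG₁Q†` (`B9Eq3126GreenLettersVariational.re_inner_K_ge_of_test`) needs a FORM bound
`re⟪u, Δ_a u⟫ ≤ M_u‖ψ‖²` of the test family; at the flat background `re⟪u, Δ_a(1)u⟫ ≤ ‖curl u‖² + ‖D*u‖² + a‖Q(1)u‖²` (the curvature part vanishes, the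
restriction `R` is a contraction), and the first two are `η⁻²` times sums of squared forward differences of `u`.  For a block-product lift those differences
are at most `D·‖ψ(blk x, κ)‖` per step — INSIDE a block one profile factor moves, ACROSS a face both coefficients vanish — so each form is
`|η|⁻²D²·O(d)·(c₀L^d∕c₁)·‖ψ‖²`, i.e. `(ηL)⁻²` times a number once `D ∝ L^{2d}` is matched against the pairing margin `∝ L^{2d+1}` of `B9Eq3126BondTentLift`
(the averaging half of the kit).

WHAT IS PROVED (sorry-free; 0 `def`; [folklore] finite-lattice bookkeeping; nothing of [B9] asserted).
* §1 `sum_norm_sq_blockCoord` (block partition for bond fields), **`norm_sq_covDivL2K_le_of_step`** (`‖c·D*u‖² ≤ ‖c‖²D²·d·(c₀L^d∕c₁)‖ψ‖²`),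
  **`norm_sq_covCurlL2K_le_of_step`** (`‖c·curl u‖² ≤ ‖c‖²D²·4d·(c₀L^d∕c₁)‖ψ‖²`) for transporters equal to the identity and any fine bond function whose forward
  steps change `u(·,κ)` by `≤ D‖ψ(blk x, κ)‖` (Cauchy–Schwarz over directions, the shift bijections, the plaquettes `μ < ν` against all ordered pairs).
* §2 **`norm_twoProfile_step_le`** — the two-profile lift has such a per-step bound with any `D ≥ δ₁s₀^{d−1}` and (`d ≥ 2`) `D ≥ s₁δ₀s₀^{d−2}`, for profiles
  vanishing on both faces with `0 ≤ f₀ ≤ s₀`, `0 ≤ f₁ ≤ s₁` and steps `δ₀, δ₁` (the block geometry of a forward step is ne9-leaf-01's `blockCoord_shift_of_lt` ∕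
  `offset_shift_of_eq` ∕ `offset_shift_of_ne`, BY NAME).
HONEST SCOPE.  Elementary; flat transporters only; crude constants; NOT NE9, NOT the route (cell pub-balaban: NE9 NOT PRINTED ∕ NOT PROVED; «NE9 ⇐ the named
binders»; row WALLED ON A MODEL (O-NE9-1; #5 UNRULED); spine PROVED 0∕9; rung (B)+1 on a finite T⁴ — NOT infinite volume, NOT mass gap, NOT Clay).  HONEST DEPENDENCY
(cell line): continuum YM on T⁴ ⇐ BetaPertH ∧ nine spine estimates (0/9 proved); BetaPertH ⇐ (D1) ∧ (D4) ∧ CAP+tail; G-an2-4 gates asym, D1 and NE2/3/4.  NEW file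
importing `B9Eq319BlockTentLift` (ne9-leaf-01 g78) only; nothing modified.  Net new unproved facts: 0.
-/

noncomputable section

open scoped InnerProductSpace ComplexConjugate BigOperators

namespace Literature.MathematicalPhysics.QuantumFieldTheory.Balaban1983to89.B9Eq3126BondLiftEnergy

open B4Sect5Torus (TSite)
open B9SectCLatticeCarrier (Bond shift unshift)
open B9Eq311L2Pairing (WL2)
open B9Eq319QprimeTorus (fineP offset offset_lt blockCoord mem_blockOf_iff)
open B11Eq103H1Complex (BondL2K covDivL2K equiv_covDivL2K)
open B9Eq33CovDerivVector (covDiv covDiv_apply shiftEquiv)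
open B9Eq34CovCurlVector (covCurl covCurl_apply_coord)
open B9Eq310HessianOperator (PlaqL2K covCurlL2K equiv_covCurlL2K)
open B5Eq172FlatCoercivity (card_blockOf)
open B9Eq319QprimeLipschitz (sum_blockOf_sum)

/-! ## §1 The Dirichlet forms of a bond function with a per-step bound: `D*` and the curl at flat transporters -/

section Energy

variable {d : ℕ} (L : ℕ) [NeZero L] (m : Fin d → ℕ)
  {W : Type*} [NormedAddCommGroup W] [InnerProductSpace ℂ W] (c₀ : ℝ) [Fact (0 < c₀)] (c₁ : ℝ) [Fact (0 < c₁)]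

omit [InnerProductSpace ℂ W] in
/-- the block partition for bond fields: `Σ_{(x,κ)} ‖ψ(blk x, κ)‖² = L^d·Σ_{(y,κ)} ‖ψ(y,κ)‖²`. [folklore] [cite: Balaban1985Averaging, (2)–(4) pp.17–18] -/
theorem sum_norm_sq_blockCoord (ψt : Bond d m → W) :
    ∑ b : Bond d (fineP L m), ‖ψt (blockCoord L m b.1, b.2)‖ ^ 2 = (L : ℝ) ^ d * ∑ c : Bond d m, ‖ψt c‖ ^ 2 := by
  have hblk : ∀ κ : Fin d, ∑ x : TSite d (fineP L m), ‖ψt (blockCoord L m x, κ)‖ ^ 2 = (L : ℝ) ^ d * ∑ y : TSite d m, ‖ψt (y, κ)‖ ^ 2 := by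
    intro κ
    rw [← sum_blockOf_sum L m (fun x => ‖ψt (blockCoord L m x, κ)‖ ^ 2), Finset.mul_sum]
    refine Finset.sum_congr rfl fun y _ => ?_
    rw [Finset.sum_congr rfl fun x hx => by rw [(mem_blockOf_iff L m y x).1 hx], Finset.sum_const, card_blockOf, nsmul_eq_mul, Nat.cast_pow]
  rw [Fintype.sum_prod_type, Fintype.sum_prod_type, Finset.sum_comm, Finset.sum_congr rfl fun κ _ => hblk κ, ← Finset.mul_sum,
    Finset.sum_comm]

/-- **THE DIVERGENCE FORM**: if every forward step changes `u(·, κ)` by at most `D·‖ψ(blk x, κ)‖`, then for transporters equal to the identity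
`‖c·D*u‖² ≤ ‖c‖²·D²·d·(c₀L^d∕c₁)·‖ψ‖²` ((3.8) at the flat background: `(D*u)(x) = c·Σ_μ (u(x−e_μ, μ) − u(x, μ))`; Cauchy–Schwarz over the `d` directions, the
shift bijection, the block partition, the weights). [folklore] [cite: Balaban1985BackgroundPropagators, (3.8) p.392, (3.11) p.392] -/
theorem norm_sq_covDivL2K_le_of_step (c : ℂ) (S : Bond d (fineP L m) → W →ₗ[ℂ] W) (hS : ∀ b, S b = LinearMap.id)
    (ut : Bond d (fineP L m) → W) (ψ : BondL2K ℂ d m c₁ W) {D : ℝ}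
    (hstep : ∀ (x : TSite d (fineP L m)) (μ κ : Fin d),
      ‖ut (shift μ x, κ) - ut (x, κ)‖ ≤ D * ‖WL2.equiv ℂ (fun _ : Bond d m => c₁) W ψ (blockCoord L m x, κ)‖) :
    ‖covDivL2K ℂ c₀ c S ((WL2.equiv ℂ (fun _ : Bond d (fineP L m) => c₀) W).symm ut)‖ ^ 2 ≤
      ‖c‖ ^ 2 * D ^ 2 * (d : ℝ) * (c₀ * (L : ℝ) ^ d / c₁) * ‖ψ‖ ^ 2 := by
  have hc₀ : 0 < c₀ := Fact.out
  have hc₁ : 0 < c₁ := Fact.out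
  set ψt := WL2.equiv ℂ (fun _ : Bond d m => c₁) W ψ with hψt
  rw [WL2.norm_sq]
  -- pointwise: `‖(D*u)(y)‖² ≤ ‖c‖²D²·d·Σ_μ ‖ψ(blk(y − e_μ), μ)‖²`
  have hpt : ∀ y : TSite d (fineP L m), c₀ * ‖WL2.equiv ℂ (fun _ : TSite d (fineP L m) => c₀) W
      (covDivL2K ℂ c₀ c S ((WL2.equiv ℂ (fun _ : Bond d (fineP L m) => c₀) W).symm ut)) y‖ ^ 2 ≤
      c₀ * (‖c‖ ^ 2 * D ^ 2 * ((d : ℝ) * ∑ μ : Fin d, ‖ψt (blockCoord L m (unshift μ y), μ)‖ ^ 2)) := by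
    intro y
    refine mul_le_mul_of_nonneg_left ?_ hc₀.le
    rw [equiv_covDivL2K, covDiv_apply, Equiv.apply_symm_apply, norm_smul]
    have h1 : ‖∑ μ : Fin d, (S (unshift μ y, μ) (ut (unshift μ y, μ)) - ut (y, μ))‖ ≤ ∑ μ : Fin d, D * ‖ψt (blockCoord L m (unshift μ y), μ)‖ := by
      refine (norm_sum_le _ _).trans (Finset.sum_le_sum fun μ _ => ?_)
      have h := hstep (unshift μ y) μ μ
      rw [B9SectCLatticeCarrier.shift_unshift] at h
      rw [hS, LinearMap.id_apply, ← norm_neg, neg_sub]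
      exact h
    have h2 : (∑ μ : Fin d, D * ‖ψt (blockCoord L m (unshift μ y), μ)‖) ^ 2 ≤
        (d : ℝ) * ∑ μ : Fin d, (D * ‖ψt (blockCoord L m (unshift μ y), μ)‖) ^ 2 := by
      have h := sq_sum_le_card_mul_sum_sq (s := (Finset.univ : Finset (Fin d))) (f := fun μ => D * ‖ψt (blockCoord L m (unshift μ y), μ)‖)
      rwa [Finset.card_univ, Fintype.card_fin] at h
    calc (‖c‖ * ‖∑ μ : Fin d, (S (unshift μ y, μ) (ut (unshift μ y, μ)) - ut (y, μ))‖) ^ 2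
        ≤ (‖c‖ * ∑ μ : Fin d, D * ‖ψt (blockCoord L m (unshift μ y), μ)‖) ^ 2 := by
          refine pow_le_pow_left₀ (by positivity) (mul_le_mul_of_nonneg_left h1 (norm_nonneg _)) 2
      _ ≤ ‖c‖ ^ 2 * ((d : ℝ) * ∑ μ : Fin d, (D * ‖ψt (blockCoord L m (unshift μ y), μ)‖) ^ 2) := by
          rw [mul_pow]; exact mul_le_mul_of_nonneg_left h2 (sq_nonneg _)
      _ = ‖c‖ ^ 2 * D ^ 2 * ((d : ℝ) * ∑ μ : Fin d, ‖ψt (blockCoord L m (unshift μ y), μ)‖ ^ 2) := by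
          rw [Finset.mul_sum, Finset.mul_sum, Finset.mul_sum, Finset.mul_sum]
          refine Finset.sum_congr rfl fun μ _ => by ring
  refine (Finset.sum_le_sum fun y _ => hpt y).trans (le_of_eq ?_)
  -- the shift bijection, direction by direction, then the block partition and the weights
  have hshift : ∑ y : TSite d (fineP L m), ∑ μ : Fin d, ‖ψt (blockCoord L m (unshift μ y), μ)‖ ^ 2 =
      ∑ b : Bond d (fineP L m), ‖ψt (blockCoord L m b.1, b.2)‖ ^ 2 := by
    rw [Fintype.sum_prod_type]
    calc ∑ y : TSite d (fineP L m), ∑ μ : Fin d, ‖ψt (blockCoord L m (unshift μ y), μ)‖ ^ 2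
        = ∑ μ : Fin d, ∑ y : TSite d (fineP L m), ‖ψt (blockCoord L m (unshift μ y), μ)‖ ^ 2 := Finset.sum_comm
      _ = ∑ μ : Fin d, ∑ y : TSite d (fineP L m), ‖ψt (blockCoord L m y, μ)‖ ^ 2 :=
          Finset.sum_congr rfl fun μ _ => Fintype.sum_equiv (shiftEquiv (Pd := fineP L m) μ).symm _ _ fun y => rfl
      _ = ∑ y : TSite d (fineP L m), ∑ μ : Fin d, ‖ψt (blockCoord L m y, μ)‖ ^ 2 := Finset.sum_comm
  have hψ : ‖ψ‖ ^ 2 = c₁ * ∑ cc : Bond d m, ‖ψt cc‖ ^ 2 := by rw [WL2.norm_sq, Finset.mul_sum]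
  calc ∑ y : TSite d (fineP L m), c₀ * (‖c‖ ^ 2 * D ^ 2 * ((d : ℝ) * ∑ μ : Fin d, ‖ψt (blockCoord L m (unshift μ y), μ)‖ ^ 2))
      = c₀ * ‖c‖ ^ 2 * D ^ 2 * (d : ℝ) * ∑ y : TSite d (fineP L m), ∑ μ : Fin d, ‖ψt (blockCoord L m (unshift μ y), μ)‖ ^ 2 := by
        rw [Finset.mul_sum]
        exact Finset.sum_congr rfl fun y _ => by ring
    _ = c₀ * ‖c‖ ^ 2 * D ^ 2 * (d : ℝ) * ((L : ℝ) ^ d * ∑ cc : Bond d m, ‖ψt cc‖ ^ 2) := by rw [hshift, sum_norm_sq_blockCoord L m ψt]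
    _ = ‖c‖ ^ 2 * D ^ 2 * (d : ℝ) * (c₀ * (L : ℝ) ^ d / c₁) * ‖ψ‖ ^ 2 := by
        rw [hψ]
        field_simp


/-- **THE CURL FORM**: under the same per-step bound, for transporters equal to the identity `‖c·curl u‖² ≤ ‖c‖²·D²·4d·(c₀L^d∕c₁)·‖ψ‖²` ((3.4) at the
flat background: `(curl u)(p_{μν}(x)) = c(u(x+e_μ,ν) − u(x,ν)) − c(u(x+e_ν,μ) − u(x,μ))`; the plaquettes `μ < ν` are bounded by all ordered pairs). [folklore]
[cite: Balaban1985BackgroundPropagators, (3.4) p.391, (3.10)–(3.11) p.392] -/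
theorem norm_sq_covCurlL2K_le_of_step (c : ℂ) (R : Bond d (fineP L m) → W →ₗ[ℂ] W) (hR : ∀ b, R b = LinearMap.id)
    (ut : Bond d (fineP L m) → W) (ψ : BondL2K ℂ d m c₁ W) {D : ℝ}
    (hstep : ∀ (x : TSite d (fineP L m)) (μ κ : Fin d),
      ‖ut (shift μ x, κ) - ut (x, κ)‖ ≤ D * ‖WL2.equiv ℂ (fun _ : Bond d m => c₁) W ψ (blockCoord L m x, κ)‖) :
    ‖covCurlL2K ℂ c₀ c R ((WL2.equiv ℂ (fun _ : Bond d (fineP L m) => c₀) W).symm ut)‖ ^ 2 ≤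
      ‖c‖ ^ 2 * D ^ 2 * (4 * (d : ℝ)) * (c₀ * (L : ℝ) ^ d / c₁) * ‖ψ‖ ^ 2 := by
  have hc₀ : 0 < c₀ := Fact.out
  have hc₁ : 0 < c₁ := Fact.out
  set ψt := WL2.equiv ℂ (fun _ : Bond d m => c₁) W ψ with hψt
  set g : TSite d (fineP L m) → Fin d → ℝ := fun x κ => ‖ψt (blockCoord L m x, κ)‖ ^ 2 with hg
  rw [WL2.norm_sq, Fintype.sum_prod_type]
  -- pointwise on a plaquette `(x, μ < ν)`
  have hpt : ∀ (x : TSite d (fineP L m)) (q : B9SectCLatticeCarrier.DirPair d),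
      c₀ * ‖WL2.equiv ℂ (fun _ : B9SectCLatticeCarrier.Plaq d (fineP L m) => c₀) W
        (covCurlL2K ℂ c₀ c R ((WL2.equiv ℂ (fun _ : Bond d (fineP L m) => c₀) W).symm ut)) (x, q)‖ ^ 2 ≤
      c₀ * (2 * ‖c‖ ^ 2 * D ^ 2 * (g x q.1.2 + g x q.1.1)) := by
    intro x q
    refine mul_le_mul_of_nonneg_left ?_ hc₀.le
    rw [equiv_covCurlL2K, Equiv.apply_symm_apply, covCurl_apply_coord, hR, hR, LinearMap.id_apply, LinearMap.id_apply]
    have h1 : ‖c • (ut (shift q.1.1 x, q.1.2) - ut (x, q.1.2)) - c • (ut (shift q.1.2 x, q.1.1) - ut (x, q.1.1))‖ ≤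
        ‖c‖ * (D * ‖ψt (blockCoord L m x, q.1.2)‖) + ‖c‖ * (D * ‖ψt (blockCoord L m x, q.1.1)‖) := by
      refine (norm_sub_le _ _).trans (add_le_add ?_ ?_)
      · rw [norm_smul]; exact mul_le_mul_of_nonneg_left (hstep x q.1.1 q.1.2) (norm_nonneg _)
      · rw [norm_smul]; exact mul_le_mul_of_nonneg_left (hstep x q.1.2 q.1.1) (norm_nonneg _)
    refine (pow_le_pow_left₀ (norm_nonneg _) h1 2).trans ?_
    rw [hg]
    nlinarith [sq_nonneg (‖c‖ * (D * ‖ψt (blockCoord L m x, q.1.2)‖) - ‖c‖ * (D * ‖ψt (blockCoord L m x, q.1.1)‖))]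
  refine (Finset.sum_le_sum fun x _ => Finset.sum_le_sum fun q _ => hpt x q).trans ?_
  -- the plaquettes `μ < ν` against all ordered pairs
  have hpair : ∀ x : TSite d (fineP L m), ∑ q : B9SectCLatticeCarrier.DirPair d, c₀ * (2 * ‖c‖ ^ 2 * D ^ 2 * (g x q.1.2 + g x q.1.1)) ≤
      c₀ * (2 * ‖c‖ ^ 2 * D ^ 2) * (2 * (d : ℝ) * ∑ κ : Fin d, g x κ) := by
    intro x
    have hall : ∑ p : Fin d × Fin d, (g x p.2 + g x p.1) = 2 * (d : ℝ) * ∑ κ : Fin d, g x κ := by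
      rw [Finset.sum_add_distrib, Fintype.sum_prod_type, Fintype.sum_prod_type]
      simp only [Finset.sum_const, Finset.card_univ, Fintype.card_fin, nsmul_eq_mul]
      rw [← Finset.mul_sum]
      ring
    have hsub : ∑ q : B9SectCLatticeCarrier.DirPair d, (g x q.1.2 + g x q.1.1) ≤ ∑ p : Fin d × Fin d, (g x p.2 + g x p.1) := by
      rw [← Fintype.sum_subtype_add_sum_subtype (fun p : Fin d × Fin d => p.1 < p.2) (fun p => g x p.2 + g x p.1)]
      exact le_add_of_nonneg_right (Finset.sum_nonneg fun p _ => by positivity)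
    have e : ∑ q : B9SectCLatticeCarrier.DirPair d, c₀ * (2 * ‖c‖ ^ 2 * D ^ 2 * (g x q.1.2 + g x q.1.1)) =
        c₀ * (2 * ‖c‖ ^ 2 * D ^ 2) * ∑ q : B9SectCLatticeCarrier.DirPair d, (g x q.1.2 + g x q.1.1) := by
      rw [Finset.mul_sum]
      exact Finset.sum_congr rfl fun q _ => by ring
    rw [e, ← hall]
    exact mul_le_mul_of_nonneg_left hsub (by positivity)
  refine (Finset.sum_le_sum fun x _ => hpair x).trans (le_of_eq ?_)
  have hψ : ‖ψ‖ ^ 2 = c₁ * ∑ cc : Bond d m, ‖ψt cc‖ ^ 2 := by rw [WL2.norm_sq, Finset.mul_sum]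
  have hsum : ∑ x : TSite d (fineP L m), ∑ κ : Fin d, g x κ = (L : ℝ) ^ d * ∑ cc : Bond d m, ‖ψt cc‖ ^ 2 := by
    rw [hg, ← sum_norm_sq_blockCoord L m ψt, Fintype.sum_prod_type]
  have e2 : ∑ x : TSite d (fineP L m), 2 * (d : ℝ) * ∑ κ : Fin d, g x κ = 2 * (d : ℝ) * ((L : ℝ) ^ d * ∑ cc : Bond d m, ‖ψt cc‖ ^ 2) := by
    rw [← hsum, Finset.mul_sum]
  rw [← Finset.mul_sum, e2, hψ]
  field_simp
  ring

end Energy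

/-! ## §2 The per-step bound of the two-profile lift: interior steps move one factor, face steps see two zeros -/

section Step

variable {d : ℕ} (L : ℕ) [NeZero L] (m : Fin d → ℕ) {W : Type*} [NormedAddCommGroup W] [NormedSpace ℂ W]

/-- **THE TWO-PROFILE LIFT IS LIPSCHITZ PER FORWARD STEP WITH THE COARSE VALUE FROZEN**: for profiles `f₀, f₁` vanishing on both faces (`k = 0`,
`k = L−1`), with `0 ≤ f₀ ≤ s₀`, `0 ≤ f₁ ≤ s₁`, `|f₀(k+1) − f₀(k)| ≤ δ₀`, `|f₁(k+1) − f₁(k)| ≤ δ₁` inside a block, and any `D` with `δ₁s₀^{d−1} ≤ D` and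
(`d ≥ 2`) `s₁δ₀s₀^{d−2} ≤ D`: the coefficient `T(x,κ) = f₁(off_κ x)·Π_{ν≠κ}f₀(off_ν x)` satisfies
`‖T(x+e_μ,κ)·ψ(blk(x+e_μ),κ) − T(x,κ)·ψ(blk x,κ)‖ ≤ D·‖ψ(blk x, κ)‖` — inside a block one factor moves (`f₁` if `μ = κ`, one `f₀` if `μ ≠ κ`); across a face
both coefficients vanish. [folklore] [cite: Balaban1985Averaging, (2) p.17, (125) p.36; Balaban1984PropagatorsII, (2.74)–(2.77) p.236] -/
theorem norm_twoProfile_step_le (f₀ f₁ : ℕ → ℝ) {s₀ s₁ δ₀ δ₁ D : ℝ} (hD : 0 ≤ D)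
    (h0nn : ∀ k, k < L → 0 ≤ f₀ k) (h0le : ∀ k, k < L → f₀ k ≤ s₀) (h0z : f₀ 0 = 0) (h0last : ∀ k, k + 1 = L → f₀ k = 0)
    (h0st : ∀ k, k + 1 < L → |f₀ (k + 1) - f₀ k| ≤ δ₀)
    (h1nn : ∀ k, k < L → 0 ≤ f₁ k) (h1le : ∀ k, k < L → f₁ k ≤ s₁) (h1z : f₁ 0 = 0) (h1last : ∀ k, k + 1 = L → f₁ k = 0)
    (h1st : ∀ k, k + 1 < L → |f₁ (k + 1) - f₁ k| ≤ δ₁)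
    (hD1 : δ₁ * s₀ ^ (d - 1) ≤ D) (hD2 : 2 ≤ d → s₁ * δ₀ * s₀ ^ (d - 2) ≤ D)
    (ψt : Bond d m → W) (x : TSite d (fineP L m)) (μ κ : Fin d) :
    ‖((f₁ (offset L m (shift μ x) κ) * ∏ ν ∈ Finset.univ.erase κ, f₀ (offset L m (shift μ x) ν) : ℝ) : ℂ) • ψt (blockCoord L m (shift μ x), κ) -
        ((f₁ (offset L m x κ) * ∏ ν ∈ Finset.univ.erase κ, f₀ (offset L m x ν) : ℝ) : ℂ) • ψt (blockCoord L m x, κ)‖ ≤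
      D * ‖ψt (blockCoord L m x, κ)‖ := by
  have hkL : offset L m x μ + 1 ≤ L := offset_lt L m x μ
  rcases hkL.lt_or_eq with hlt | heq
  · -- interior step: same block; one factor moves
    obtain ⟨hblk, hoff⟩ := B9Eq319BlockTentLift.blockCoord_shift_of_lt L m x hlt
    rw [hblk, ← sub_smul, ← Complex.ofReal_sub, norm_smul, Complex.norm_real, Real.norm_eq_abs]
    refine mul_le_mul_of_nonneg_right ?_ (norm_nonneg _)
    by_cases hμκ : μ = κ
    · subst hμκ
      -- the transverse factors are unchanged, `f₁` moves by `≤ δ₁`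
      have hP : ∏ ν ∈ Finset.univ.erase μ, f₀ (offset L m (shift μ x) ν) = ∏ ν ∈ Finset.univ.erase μ, f₀ (offset L m x ν) :=
        Finset.prod_congr rfl fun ν hν => by rw [B9Eq319BlockTentLift.offset_shift_of_ne L m x (Finset.ne_of_mem_erase hν)]
      have hP0 : 0 ≤ ∏ ν ∈ Finset.univ.erase μ, f₀ (offset L m x ν) := Finset.prod_nonneg fun ν _ => h0nn _ (offset_lt L m x ν)
      have hPle : ∏ ν ∈ Finset.univ.erase μ, f₀ (offset L m x ν) ≤ s₀ ^ (d - 1) := by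
        have h := Finset.prod_le_prod (s := Finset.univ.erase μ) (fun ν _ => h0nn _ (offset_lt L m x ν)) (fun ν _ => h0le _ (offset_lt L m x ν))
        rwa [Finset.prod_const, Finset.card_erase_of_mem (Finset.mem_univ μ), Finset.card_univ, Fintype.card_fin] at h
      rw [hP, hoff, ← sub_mul, abs_mul, abs_of_nonneg hP0]
      exact (mul_le_mul (h1st _ hlt) hPle hP0 (le_trans (abs_nonneg _) (h1st _ hlt))).trans hD1
    · -- `μ ≠ κ`: `f₁(off_κ)` unchanged, the factor `f₀(off_μ)` moves by `≤ δ₀`, the other `d − 2` factors are `≤ s₀`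
      have hd2 : 2 ≤ d := by
        have : Fintype.card (Fin d) ≥ 2 := by
          have h := Finset.card_le_univ ({μ, κ} : Finset (Fin d))
          rwa [Finset.card_pair hμκ] at h
        simpa using this
      have hκμ : κ ≠ μ := fun h => hμκ h.symm
      have hμmem : μ ∈ Finset.univ.erase κ := Finset.mem_erase.2 ⟨hμκ, Finset.mem_univ μ⟩
      set Rr := ∏ ν ∈ (Finset.univ.erase κ).erase μ, f₀ (offset L m x ν) with hRr
      have hR0 : 0 ≤ Rr := Finset.prod_nonneg fun ν _ => h0nn _ (offset_lt L m x ν)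
      have hRle : Rr ≤ s₀ ^ (d - 2) := by
        have h := Finset.prod_le_prod (s := (Finset.univ.erase κ).erase μ) (fun ν _ => h0nn _ (offset_lt L m x ν)) (fun ν _ => h0le _ (offset_lt L m x ν))
        rwa [Finset.prod_const, Finset.card_erase_of_mem hμmem, Finset.card_erase_of_mem (Finset.mem_univ κ), Finset.card_univ, Fintype.card_fin]
          at h
      have e1 : ∏ ν ∈ Finset.univ.erase κ, f₀ (offset L m x ν) = f₀ (offset L m x μ) * Rr := (Finset.mul_prod_erase _ _ hμmem).symm
      have e2 : ∏ ν ∈ Finset.univ.erase κ, f₀ (offset L m (shift μ x) ν) = f₀ (offset L m x μ + 1) * Rr := by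
        rw [← Finset.mul_prod_erase _ _ hμmem, hoff]
        congr 1
        exact Finset.prod_congr rfl fun ν hν => by
          rw [B9Eq319BlockTentLift.offset_shift_of_ne L m x (Finset.ne_of_mem_erase hν)]
      rw [B9Eq319BlockTentLift.offset_shift_of_ne L m x hκμ, e1, e2]
      have e3 : f₁ (offset L m x κ) * (f₀ (offset L m x μ + 1) * Rr) - f₁ (offset L m x κ) * (f₀ (offset L m x μ) * Rr) =
          f₁ (offset L m x κ) * (f₀ (offset L m x μ + 1) - f₀ (offset L m x μ)) * Rr := by ring
      rw [e3, abs_mul, abs_mul, abs_of_nonneg hR0, abs_of_nonneg (h1nn _ (offset_lt L m x κ))]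
      calc f₁ (offset L m x κ) * |f₀ (offset L m x μ + 1) - f₀ (offset L m x μ)| * Rr ≤ s₁ * δ₀ * s₀ ^ (d - 2) := by
            refine mul_le_mul (mul_le_mul (h1le _ (offset_lt L m x κ)) (h0st _ hlt) (abs_nonneg _) ?_) hRle hR0 ?_
            · exact le_trans (h1nn _ (offset_lt L m x κ)) (h1le _ (offset_lt L m x κ))
            · exact mul_nonneg (le_trans (h1nn _ (offset_lt L m x κ)) (h1le _ (offset_lt L m x κ))) (le_trans (abs_nonneg _) (h0st _ hlt))
        _ ≤ D := hD2 hd2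
  · -- face step: both coefficients vanish
    have hz1 : f₁ (offset L m x κ) * ∏ ν ∈ Finset.univ.erase κ, f₀ (offset L m x ν) = 0 := by
      by_cases hμκ : μ = κ
      · subst hμκ; rw [h1last _ heq, zero_mul]
      · rw [Finset.prod_eq_zero (Finset.mem_erase.2 ⟨hμκ, Finset.mem_univ μ⟩) (h0last _ heq), mul_zero]
    have hz2 : f₁ (offset L m (shift μ x) κ) * ∏ ν ∈ Finset.univ.erase κ, f₀ (offset L m (shift μ x) ν) = 0 := by
      have h0 := B9Eq319BlockTentLift.offset_shift_of_eq L m x heq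
      by_cases hμκ : μ = κ
      · subst hμκ; rw [h0, h1z, zero_mul]
      · rw [Finset.prod_eq_zero (Finset.mem_erase.2 ⟨hμκ, Finset.mem_univ μ⟩) (by rw [h0, h0z]), mul_zero]
    rw [hz1, hz2, Complex.ofReal_zero, zero_smul, zero_smul, sub_zero, norm_zero]
    positivity

end Step

end Literature.MathematicalPhysics.QuantumFieldTheory.Balaban1983to89.B9Eq3126BondLiftEnergy

end
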